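import Summits.HodgeConjecture.CorCM.Census.OddDegreeParityLaw

/-!
# Odd slices, I: Galois translation, divisor pairs and reduction modulo pairs in the Pohlmann model

COR-CM (cell `pub-hodgecm2`), count-neutral kernel census by the binder seat b09 (gen 24; lane DEG22-MU, answering lit-andre-3's
ask A6-R35 «`ℤ/22`: is `μ = 93`?»), in the generic odd-slice model of `Census/OddDegreeParityLaw.lean` (b17 gen 48) — no `decide`
table, no certificate, no named fact, no geometry, no `sorry`.  HC_CM is not proved anywhere in this cell; nothing here is a
headline and nothing here produces a period.

Part I of three (`OddSliceTranslation` → `OddSliceGenerators` → `OddSliceUpperBound`): generic facts about the model of the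
parity-law file (verbatim its §1: additive group `A`, `G = ℤ/2 × A`, blocks `b ∈ ι` with finite label groups `A_b`, `π_b : A →+ A_b`,
types `φ_b : A_b → ℤ/2`, labels `Pt = Σ b, ℤ/2 × A_b`, `act`, `hodgeVec`, `hodgeLattice` (`H`), `conj`, `pairVec`, `pairs` (`P`),
`transl`).  CONTENT: translation by `g` is a permutation of the labels (`actEquiv`) and `act g ∘ act h = act (h + g)`; the Pohlmann
form of `h` on a translate is the form of `g + h` (`hodgeVec_dotProduct_transl`), so **`H` is `G`-stable** (`transl_mem`); the
coefficients at conjugate labels are opposite, so **`P ≤ H`** (`pairVec_mem`, `pairs_le_hodgeLattice`); the form of `(1,t)` is minus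
the form of `(0,t)` (`hodgeVec_one`, `mem_hodgeLattice_iff`); unit vectors on the sigma type of labels (`single_apply_of_ne`,
`single_apply_same`); and the REDUCTION MODULO PAIRS `red u = u − Σ_{x odd} u_x · pairVec x` (`red_apply`: value
`u(b,0,y) − u(b,1,y)` on even labels, `0` on odd ones; `sub_red_mem_pairs`, `red_mem`).  All [folklore]; used by parts II–III for
the upper bound `μ ≤ |ι| − 1` matching b17's parity law.

## References
* [Pohlmann1968] H. Pohlmann, Algebraic cycles on abelian varieties of complex multiplication type, Ann. of Math. 88 (1968), Thm 1.
* [Milne1999] J. S. Milne, Lefschetz motives and the Tate conjecture, Compositio Math. 117 (1999), Prop. 2.1, p. 54.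
* [Weil1977HodgeRing] A. Weil, Abelian varieties and the Hodge ring, Œuvres Scientifiques III, [1977c], 421–429.
-/

namespace Summit.HodgeConjecture.CorCM.Census.OddSliceTranslation

open Finset
open Summit.HodgeConjecture.CorCM.Census.OddDegreeParityLaw

variable {A : Type*} [AddCommGroup A]
variable {ι : Type*} [Fintype ι] [DecidableEq ι]
variable {Ab : ι → Type*} [∀ b, AddCommGroup (Ab b)] [∀ b, Fintype (Ab b)] [∀ b, DecidableEq (Ab b)]

/-! ## §1 Translation: the action as a permutation of the labels; `H` is `G`-stable and contains the pairs -/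

omit [Fintype ι] [DecidableEq ι] [∀ b, Fintype (Ab b)] [∀ b, DecidableEq (Ab b)] in
/-- Translation by `g` and by `−g` are inverse to each other. [folklore] -/
theorem act_neg_act (π : ∀ b, A →+ Ab b) (g : ZMod 2 × A) (x : Pt Ab) : act π (-g) (act π g x) = x := by
  obtain ⟨b, a, y⟩ := x
  show (⟨b, (a + g.1 + (-g).1, y + π b g.2 + π b (-g).2)⟩ : Pt Ab) = ⟨b, (a, y)⟩
  rw [Prod.fst_neg, Prod.snd_neg, map_neg, add_neg_cancel_right, add_neg_cancel_right]

omit [Fintype ι] [DecidableEq ι] [∀ b, Fintype (Ab b)] [∀ b, DecidableEq (Ab b)] in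
/-- Translation by `−g` and by `g` are inverse to each other. [folklore] -/
theorem act_act_neg (π : ∀ b, A →+ Ab b) (g : ZMod 2 × A) (x : Pt Ab) : act π g (act π (-g) x) = x := by
  simpa using act_neg_act π (-g) x

/-- Translation by `g ∈ ℤ/2 × A` as a permutation of the labels. [folklore] -/
def actEquiv (π : ∀ b, A →+ Ab b) (g : ZMod 2 × A) : Pt Ab ≃ Pt Ab where
  toFun := act π g
  invFun := act π (-g)
  left_inv := act_neg_act π g
  right_inv := act_act_neg π g

omit [Fintype ι] [DecidableEq ι] [∀ b, Fintype (Ab b)] [∀ b, DecidableEq (Ab b)] in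
/-- Composition of translations. [folklore] -/
theorem act_act (π : ∀ b, A →+ Ab b) (g h : ZMod 2 × A) (x : Pt Ab) : act π g (act π h x) = act π (h + g) x := by
  obtain ⟨b, a, y⟩ := x
  show (⟨b, (a + h.1 + g.1, y + π b h.2 + π b g.2)⟩ : Pt Ab) = ⟨b, (a + (h + g).1, y + π b (h + g).2)⟩
  rw [Prod.fst_add, Prod.snd_add, map_add, add_assoc, add_assoc y]

omit [Fintype ι] [DecidableEq ι] [∀ b, Fintype (Ab b)] [∀ b, DecidableEq (Ab b)] in
/-- The Pohlmann coefficient of `g` at a translated label. [folklore] -/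
theorem hodgeVec_act (π : ∀ b, A →+ Ab b) (φ : ∀ b, Ab b → ZMod 2) (g h : ZMod 2 × A) (x : Pt Ab) :
    hodgeVec π φ g (act π h x) = hodgeVec π φ (h + g) x := by
  simp only [hodgeVec, act_act]

omit [Fintype ι] [DecidableEq ι] [∀ b, Fintype (Ab b)] [∀ b, DecidableEq (Ab b)] in
/-- `transl` as composition with the inverse permutation. [folklore] -/
theorem transl_eq_comp (π : ∀ b, A →+ Ab b) (g : ZMod 2 × A) (v : Pt Ab → ℤ) :
    transl π g v = v ∘ (actEquiv π g).symm := rfl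

omit [DecidableEq ι] [∀ b, DecidableEq (Ab b)] in
/-- The Pohlmann form of `h` on a translate is the form of `g + h` on the original vector. [folklore] -/
theorem hodgeVec_dotProduct_transl (π : ∀ b, A →+ Ab b) (φ : ∀ b, Ab b → ZMod 2) (g h : ZMod 2 × A) (v : Pt Ab → ℤ) :
    hodgeVec π φ h ⬝ᵥ transl π g v = hodgeVec π φ (g + h) ⬝ᵥ v := by
  rw [transl_eq_comp, dotProduct_comp_equiv_symm]
  congr 1
  funext x
  exact hodgeVec_act π φ h g x

omit [DecidableEq ι] [∀ b, DecidableEq (Ab b)] in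
/-- **The Hodge lattice is stable under Galois translation.** [folklore] -/
theorem transl_mem (π : ∀ b, A →+ Ab b) (φ : ∀ b, Ab b → ZMod 2) {v : Pt Ab → ℤ} (hv : v ∈ hodgeLattice π φ)
    (g : ZMod 2 × A) : transl π g v ∈ hodgeLattice π φ := by
  intro h
  rw [hodgeVec_dotProduct_transl]
  exact hv (g + h)

omit [Fintype ι] [∀ b, Fintype (Ab b)] in
/-- Translate of a unit vector. [folklore] -/
theorem transl_single (π : ∀ b, A →+ Ab b) (g : ZMod 2 × A) (x : Pt Ab) (c : ℤ) :
    transl π g (Pi.single x c) = Pi.single (act π g x) c := by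
  funext z
  have hiff : act π (-g) z = x ↔ z = act π g x := by
    constructor
    · intro h; rw [← h, act_act_neg]
    · intro h; rw [h, act_neg_act]
  simp only [transl, Pi.single_apply, hiff]

/-- Translation by `g` as a `ℤ`-linear map. [folklore] -/
def translHom (π : ∀ b, A →+ Ab b) (g : ZMod 2 × A) : (Pt Ab → ℤ) →ₗ[ℤ] (Pt Ab → ℤ) where
  toFun := transl π g
  map_add' _ _ := rfl
  map_smul' _ _ := rfl

omit [Fintype ι] [DecidableEq ι] [∀ b, Fintype (Ab b)] [∀ b, DecidableEq (Ab b)] in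
/-- `translHom` is `transl`. [folklore] -/
@[simp] theorem translHom_apply (π : ∀ b, A →+ Ab b) (g : ZMod 2 × A) (v : Pt Ab → ℤ) :
    translHom π g v = transl π g v := rfl

/-- In `ℤ/2`, `u + 1 = w ↔ ¬ u = w`. [folklore] -/
theorem _root_.Summit.HodgeConjecture.CorCM.Census.OddSliceUpperBound.zmod2_add_one_eq_iff (u w : ZMod 2) : u + 1 = w ↔ ¬ u = w := by
  revert u w; decide

omit [Fintype ι] [DecidableEq ι] [∀ b, Fintype (Ab b)] [∀ b, DecidableEq (Ab b)] in
/-- The Pohlmann coefficients at conjugate labels are opposite. [folklore] -/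
theorem hodgeVec_conj (π : ∀ b, A →+ Ab b) (φ : ∀ b, Ab b → ZMod 2) (g : ZMod 2 × A) (x : Pt Ab) :
    hodgeVec π φ g (conj x) = -hodgeVec π φ g x := by
  obtain ⟨b, a, y⟩ := x
  have key : ∀ u w : ZMod 2, (if u + 1 = w then (1 : ℤ) else -1) = -(if u = w then (1 : ℤ) else -1) := by decide
  simp only [hodgeVec, act, conj, inPhi, decide_eq_true_eq]
  rw [add_right_comm]
  exact key _ _

/-- **The conjugate pairs are Hodge vectors.** [folklore] -/
theorem pairVec_mem (π : ∀ b, A →+ Ab b) (φ : ∀ b, Ab b → ZMod 2) (x : Pt Ab) :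
    pairVec x ∈ hodgeLattice π φ := by
  intro g
  show hodgeVec π φ g ⬝ᵥ (Pi.single x 1 + Pi.single (conj x) 1) = 0
  rw [dotProduct_add, dotProduct_single, dotProduct_single, hodgeVec_conj]
  ring

/-- The divisor lattice lies in the Hodge lattice. [folklore] -/
theorem pairs_le_hodgeLattice (π : ∀ b, A →+ Ab b) (φ : ∀ b, Ab b → ZMod 2) :
    (pairs : Submodule ℤ (Pt Ab → ℤ)) ≤ hodgeLattice π φ := by
  refine Submodule.span_le.mpr ?_
  rintro _ ⟨x, rfl⟩
  exact pairVec_mem π φ x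

omit [Fintype ι] [DecidableEq ι] [∀ b, Fintype (Ab b)] [∀ b, DecidableEq (Ab b)] in
/-- The form of `(1, t)` is minus the form of `(0, t)`. [folklore] -/
theorem hodgeVec_one (π : ∀ b, A →+ Ab b) (φ : ∀ b, Ab b → ZMod 2) (t : A) (x : Pt Ab) :
    hodgeVec π φ (1, t) x = -hodgeVec π φ (0, t) x := by
  obtain ⟨b, a, y⟩ := x
  have key : ∀ u w : ZMod 2, (if u + 1 = w then (1 : ℤ) else -1) = -(if u = w then (1 : ℤ) else -1) := by decide
  simp only [hodgeVec, act, inPhi, decide_eq_true_eq, add_zero]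
  exact key _ _

omit [DecidableEq ι] [∀ b, DecidableEq (Ab b)] in
/-- Membership in `H` can be tested on the forms of `(0, t)`, `t ∈ A`. [folklore] -/
theorem mem_hodgeLattice_iff (π : ∀ b, A →+ Ab b) (φ : ∀ b, Ab b → ZMod 2) (m : Pt Ab → ℤ) :
    m ∈ hodgeLattice π φ ↔ ∀ t : A, hodgeVec π φ (0, t) ⬝ᵥ m = 0 := by
  constructor
  · intro h t; exact h (0, t)
  · intro h g
    obtain ⟨a, t⟩ := g
    have h01 : ∀ a : ZMod 2, a = 0 ∨ a = 1 := by decide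
    rcases h01 a with rfl | rfl
    · exact h t
    · have hf : hodgeVec π φ (1, t) = -hodgeVec π φ (0, t) := funext (hodgeVec_one π φ t)
      rw [hf, neg_dotProduct, h t, neg_zero]

/-- The form of `(0, t)` on a unit vector. [folklore] -/
theorem hodgeVec_zero_dotProduct_single (π : ∀ b, A →+ Ab b) (φ : ∀ b, Ab b → ZMod 2) (t : A) (b : ι) (a : ZMod 2)
    (y : Ab b) (c : ℤ) :
    hodgeVec π φ (0, t) ⬝ᵥ Pi.single (⟨b, (a, y)⟩ : Pt Ab) c = (if a = φ b (y + π b t) then 1 else -1) * c := by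
  rw [dotProduct_single]
  simp [hodgeVec, act, inPhi]

/-! ## §2 Unit vectors on the sigma type of labels -/

omit [Fintype ι] [∀ b, AddCommGroup (Ab b)] [∀ b, Fintype (Ab b)] in
/-- A unit vector of block `b` vanishes on the labels of every other block. [folklore] -/
theorem single_apply_of_ne {b b' : ι} (h : b' ≠ b) (p : ZMod 2 × Ab b) (p' : ZMod 2 × Ab b') (c : ℤ) :
    (Pi.single (⟨b, p⟩ : Pt Ab) c : Pt Ab → ℤ) ⟨b', p'⟩ = 0 := by
  rw [Pi.single_apply, if_neg]
  exact fun hh => h (congrArg Sigma.fst hh)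

omit [Fintype ι] [∀ b, AddCommGroup (Ab b)] [∀ b, Fintype (Ab b)] in
/-- A unit vector of block `b` on the labels of block `b`. [folklore] -/
theorem single_apply_same (b : ι) (p p' : ZMod 2 × Ab b) (c : ℤ) :
    (Pi.single (⟨b, p⟩ : Pt Ab) c : Pt Ab → ℤ) ⟨b, p'⟩ = if p' = p then c else 0 := by
  rw [Pi.single_apply]
  by_cases hp : p' = p
  · subst hp; rw [if_pos rfl, if_pos rfl]
  · rw [if_neg hp, if_neg]
    exact fun hh => hp (eq_of_heq (Sigma.mk.inj_iff.mp hh).2)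

/-- Pairs with different first coordinates `1 ≠ 0` in `ℤ/2` differ. [folklore] -/
theorem pair_one_ne_pair_zero {X : Type*} (y z : X) : ((1 : ZMod 2), y) ≠ ((0 : ZMod 2), z) := by
  intro h
  have h1 : (1 : ZMod 2) = 0 := (Prod.ext_iff.mp h).1
  exact absurd h1 (by decide)

/-- Pairs with first coordinate `0` agree iff their second coordinates do. [folklore] -/
theorem pair_zero_eq_iff {X : Type*} (y z : X) : ((0 : ZMod 2), y) = ((0 : ZMod 2), z) ↔ y = z :=
  ⟨fun h => (Prod.ext_iff.mp h).2, fun h => by rw [h]⟩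

/-! ## §3 Reduction modulo pairs -/

/-- The odd labels. [folklore] -/
def oddLabels : Finset (Pt Ab) := univ.filter fun x => x.2.1 = 1

/-- Reduction modulo pairs: move every odd label onto its conjugate even label. [folklore] -/
def red (u : Pt Ab → ℤ) : Pt Ab → ℤ := u - ∑ x ∈ oddLabels, u x • pairVec x

omit [Fintype ι] [DecidableEq ι] [∀ b, AddCommGroup (Ab b)] [∀ b, Fintype (Ab b)] [∀ b, DecidableEq (Ab b)] in
/-- `conj` is an involution. [folklore] -/
theorem conj_conj (x : Pt Ab) : conj (conj x) = x := by
  obtain ⟨b, a, y⟩ := x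
  show (⟨b, (a + 1 + 1, y)⟩ : Pt Ab) = ⟨b, (a, y)⟩
  have h : a + 1 + 1 = a := by
    have key : ∀ u : ZMod 2, u + 1 + 1 = u := by decide
    exact key a
  rw [h]

omit [∀ b, AddCommGroup (Ab b)] in
/-- `u − red u` is a sum of pairs. [folklore] -/
theorem sub_red_mem_pairs (u : Pt Ab → ℤ) : u - red u ∈ (pairs : Submodule ℤ (Pt Ab → ℤ)) := by
  unfold red
  rw [sub_sub_cancel]
  exact Submodule.sum_mem _ fun x _ => Submodule.smul_mem _ _ (Submodule.subset_span ⟨x, rfl⟩)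

/-- `red u` is Hodge when `u` is. [folklore] -/
theorem red_mem (π : ∀ b, A →+ Ab b) (φ : ∀ b, Ab b → ZMod 2) {u : Pt Ab → ℤ} (hu : u ∈ hodgeLattice π φ) :
    red u ∈ hodgeLattice π φ := by
  unfold red
  exact Submodule.sub_mem _ hu (Submodule.sum_mem _ fun x _ => Submodule.smul_mem _ _ (pairVec_mem π φ x))

omit [∀ b, AddCommGroup (Ab b)] in
/-- The values of `red u`: the difference `u(b,0,y) − u(b,1,y)` on even labels, `0` on odd labels. [folklore] -/
theorem red_apply (u : Pt Ab → ℤ) (b : ι) (a : ZMod 2) (y : Ab b) :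
    red u ⟨b, (a, y)⟩ = if a = 0 then u ⟨b, (0, y)⟩ - u ⟨b, (1, y)⟩ else 0 := by
  have h01 : ∀ a : ZMod 2, a = 0 ∨ a = 1 := by decide
  unfold red
  rw [Pi.sub_apply, Finset.sum_apply]
  have hterm : ∀ x ∈ (oddLabels : Finset (Pt Ab)), (u x • pairVec x) ⟨b, (a, y)⟩ =
      (if (⟨b, (a, y)⟩ : Pt Ab) = x then u x else 0) + (if conj (⟨b, (a, y)⟩ : Pt Ab) = x then u x else 0) := by
    intro x _
    have hc : ((⟨b, (a, y)⟩ : Pt Ab) = conj x) ↔ (conj (⟨b, (a, y)⟩ : Pt Ab) = x) := by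
      constructor
      · intro h; rw [h, conj_conj]
      · intro h; rw [← h, conj_conj]
    simp only [pairVec, Pi.smul_apply, Pi.add_apply, smul_eq_mul, Pi.single_apply, hc]
    split_ifs <;> ring
  rw [Finset.sum_congr rfl hterm, Finset.sum_add_distrib, Finset.sum_ite_eq, Finset.sum_ite_eq]
  have hmem : ∀ x : Pt Ab, x ∈ (oddLabels : Finset (Pt Ab)) ↔ x.2.1 = 1 := by
    intro x; simp [oddLabels]
  simp only [hmem, conj]
  rcases h01 a with rfl | rfl
  · have h1 : ((0 : ZMod 2) + 1 = 1) := by decide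
    have h2 : ¬ ((0 : ZMod 2) = 1) := by decide
    simp only [h1, h2, if_true, if_false, zero_add]
  · have h1 : ¬ ((1 : ZMod 2) + 1 = 1) := by decide
    have h2 : ¬ ((1 : ZMod 2) = 0) := by decide
    simp only [h1, h2, if_true, if_false, add_zero, sub_self]

end Summit.HodgeConjecture.CorCM.Census.OddSliceTranslation
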